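import Mathlib.LinearAlgebra.Matrix.Kronecker
import Mathlib.Analysis.SpecialFunctions.Integrals.Basic
import Mathlib.Data.Complex.BigOperators
import Mathlib.Analysis.Real.Sqrt
import Mathlib.Algebra.Order.BigOperators.Ring.Finset
import Mathlib.Algebra.Order.Chebyshev
import Mathlib.Algebra.BigOperators.Field
import Mathlib.Data.Real.Basic
import Mathlib.Tactic.Linarith
import Mathlib.Tactic.Positivity
import Mathlib.Tactic.FieldSimp
import Mathlib.Tactic.Ring
import HarnessLib

/-!
# Anticoncentration from approximate 2-design moments (Hangleiter–Bermejo-Vega–Schwarz–Eisert 2018, Theorem 5)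

Topic `Literature/Computability/QuantumComplexity` (pub-qadeq lane, CLAIMS §5: the RCS rows
E-01…E-10 describe their hardness standing as “average-case conjecture + anticoncentration”; the
standard source for “(approximate) unitary 2-designs anticoncentrate” is this theorem; companion of
`IQPAnticoncentration.lean`, where anticoncentration of Bremner–Montanaro–Shepherd's IQP families is
proved outright).

HONEST FRAMING: instance-level adjudication of specific advantage claims; no claim about BQP vs BPP
or the summit.  This file proves an inequality between the moments of a finitely supported
distribution and one of its tail probabilities; it asserts nothing about any device, and it does
NOT prove that any particular circuit family is a 2-design.

## Source statements [cite: HangleiterEtAl2018]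

D. Hangleiter, J. Bermejo-Vega, M. Schwarz, J. Eisert, *Anticoncentration theorems for schemes
showing a quantum speedup*, Quantum **2**, 65 (2018) = arXiv:1706.03786 (held text
`paper:arxiv-1706.03786`, §3.1 read by the seat 2026-08-22):

* Theorem 5 (Anticoncentration of unitary 2-designs): “Let μ be a relative ε-approximate unitary
  2-design on the group U(N). Then the output probabilities |⟨x|U|0⟩|² for x ∈ {0,1}ⁿ of a μ-random
  unitary U ∈ U(N) anticoncentrate in the sense that for 0 ≤ α ≤ 1,
  Pr_{U∼μ}(|⟨x|U|0⟩|² > α(1−ε)/N) ≥ (1−α)²(1−ε)²/(2(1+ε)).”  “Theorem 5 also holds in exactly the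
  same way for relative ε-approximate state 2-designs.”
* Its proof: the Paley–Zygmund inequality “If Z ≥ 0 is a random variable with finite variance, and if
  0 ≤ α ≤ 1, P(Z > α𝔼[Z]) ≥ (1−α)² 𝔼[Z]²/𝔼[Z²]”; the design property enters ONLY through the
  moment bounds “for l = 2, 4, (1−ε) 𝔼_{U∼Haar}[|⟨a|U|b⟩|^l] ≤ 𝔼_{U∼μ}[|⟨a|U|b⟩|^l] ≤
  (1+ε) 𝔼_{U∼Haar}[|⟨a|U|b⟩|^l]”, and Lemma 6's Haar moments “𝔼_Haar[p] = 1/N,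
  𝔼_Haar[p²] = 2/(N(N+1))”; then “Pr_{U∼μ}(… > α(1−ε)/N) ≥ (1−α)² (N(N+1))/(2N²) (1−ε)²/(1+ε)
  ≥ (1−α)² (1−ε)²/(2(1+ε))”.

* §3.1: “the moments of the output probabilities of state 2-designs are also given by
  (eq:firstandsecondmoment) [𝔼[p] = 1/N, 𝔼[p²] = 2/(N(N+1))].  This can be seen similarly using the
  fact that the expectation value over a state k-design is given by the projection onto the k-partite
  symmetric subspace of ℋ^{⊗k} [zhu_clifford_2016].”

## Source statements [cite: ZhuEtAl2016]

H. Zhu, R. Kueng, M. Grassl, D. Gross, *The Clifford group fails gracefully to be a unitary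
4-design*, arXiv:1609.08172 (2016) (held text `paper:arxiv-1609.08172`, §2.1 p. 5 read by the
seat 2026-08-22) — the reference [zhu_clifford_2016] above:

* Definition 1: “A set of K normalized vectors {ψ_j} in dimension d is a (complex projective)
  t-design if (1/K) Σ_j p(ψ_j) = ∫ p(ψ) dψ for all p ∈ Hom_{(t,t)}(ℂ^d).”
* “Let Sym_t(ℂ^d) be the t-partite symmetric subspace of (ℂ^d)^{⊗t} with corresponding projector
  P_[t].  The dimension of Sym_t(ℂ^d) reads D_[t] = binom(d+t−1, t).”
* Proposition 1: “The following statements are equivalent: (1) {ψ_j} is a t-design.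
  (2) (1/K) Σ_j (|ψ_j⟩⟨ψ_j|)^{⊗t} = P_[t]/D_[t], where K = |{ψ_j}|. (3) Φ_t({ψ_j}) = 1/D_[t].”
  For t = 2: P_[2] = (𝟙 + F)/2 with F the swap of the two tensor factors, D_[2] = d(d+1)/2, so
  statement (2) reads (1/K) Σ_j (|ψ_j⟩⟨ψ_j|)^{⊗2} = (𝟙 + F)/(d(d+1)).

## Source statements [cite: DalzellHunterJonesBrandao2022]

A. M. Dalzell, N. Hunter-Jones, F. G. S. L. Brandão, *Random quantum circuits anticoncentrate in log
depth*, PRX Quantum **3**, 010333 (2022) = arXiv:2011.12277 (held text `paper:arxiv-2011.12277`,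
§2, §7.3 and the appendix ‘Approximate 2-designs and anti-concentration’ read by the seat 2026-08-22):

* §2 / §7.3: “Z := 𝔼_U[Σ_{x∈[q]ⁿ} p_U(x)²] = qⁿ 𝔼_U[p_U(1ⁿ)²]” (the second equality “because by symmetry
  each of the qⁿ terms in the sum yields the same number under expectation”); “Z := Σ_{x∈M} Pr[X=x]²
  = 𝔼[p²]·|M| … the collision probability takes its minimal value Z = |M|⁻¹ [at the uniform
  distribution]”; Definition 3: “X … is α-anti-concentrated for 0 < α ≤ 1 if Z ≤ 1/(|M| α).  Thus a
  distribution is 1-anti-concentrated if and only if it is the uniform distribution”; Definition 4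
  (architecture): “Z := 𝔼_U[Σ_x p_U(x)²] ≤ (α qⁿ)⁻¹”; “for any β with 0 ≤ β ≤ 1 …
  Pr_U[p_U(x) ≥ β q⁻ⁿ] ≥ (1−β)² α, which follows directly from the Paley–Zygmund inequality”;
  “lim_{s→∞} Z = Z_H := 2/(qⁿ+1)”.
* Appendix ‘Approximate 2-designs and anti-concentration’: “for an exact unitary 2-design μ we find
  Z = 𝔼_μ[Σ_x p_U(x)²] = 𝔼_H[Σ_x p_U(x)²] = 2/(qⁿ+1), and thus also 1/2-anti-concentrates”.
  (Its Proposition 1 on ε-approximate designs and the paper's log-depth theorems are NOT formalised.)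

## What is formalised (all proved; 0 named facts)

The theorem with its hypothesis in the form the proof uses it: a finitely supported distribution
`μ` (weights `μ ω ≥ 0` summing to `1`) of a real quantity `p` (the output probability
`|⟨x|U|0⟩|²`) whose first moment is at least `(1−ε)·(1/N)` and whose second moment is at most
`(1+ε)·2/(N(N+1))` — the two instances of the displayed moment bounds with the Haar values of
Lemma 6 inserted (Lemma 6's printed density `(N−1)(1−p)^{N−2}` has its normalisation and its two
moments `1/N`, `2/(N(N+1))` proved in section `HaarMarginal` (v4); that the Haar-random marginal HAS
this density — a unitary-group integral — is NOT formalised, nor is the operator-inequality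
Definition 3 of a relative approximate design: TODO(general form)).

* `paleyZygmund_weighted` — `(𝔼Z − a)² ≤ 𝔼[Z²] · Pr[Z > a]` for `0 ≤ a ≤ 𝔼Z` (strict tail, weighted
  finite form; Cauchy–Schwarz).
* **`anticoncentration_of_moment_bounds`** — Theorem 5's conclusion
  `(1−α)²(1−ε)²/(2(1+ε)) ≤ Pr[p > α(1−ε)/N]`, through the sharper intermediate
  `anticoncentration_of_moment_bounds'` with the factor `(N+1)/(2N)`.
* `anticoncentration_exact` — the exact-design case `ε = 0`: `(1−α)²/2 ≤ Pr[p > α/N]`.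

Section `StateDesigns` (v2) — the exact state-2-design case carried out in full from the design
identity (no moment hypothesis left open):

* `proj ψ = |ψ⟩⟨ψ|`, `swapOp V = F`, and **`IsStateTwoDesign ψ`** — a finite family
  `ψ : J → (V → ℂ)` of unit vectors with `(1/K) Σ_j (|ψ_j⟩⟨ψ_j|) ⊗ₖ (|ψ_j⟩⟨ψ_j|) = (𝟙 + F)/(N(N+1))`
  (`K = |J|`, `N = |V|`): Zhu–Kueng–Grassl–Gross's Proposition 1, statement (2), at `t = 2`, taken
  as the definition (the integral Definition 1 and statements (1) ⇔ (2) ⇔ (3) are NOT formalised: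
  TODO(general form)).
* `IsStateTwoDesign.second_moment` / `.fourth_moment` — `(1/K) Σ_j |⟨x|ψ_j⟩|² = 1/N` and
  `(1/K) Σ_j |⟨x|ψ_j⟩|⁴ = 2/(N(N+1))` for every basis vector `x` (the `(xy,xy)` entries summed over
  `y`, resp. the `(xx,xx)` entry, of the design identity); `.card_pos` — a design is nonempty.
* **`IsStateTwoDesign.anticoncentration`** — Theorem 5 for exact state 2-designs:
  `(1−α)²/2 ≤ #{j : |⟨x|ψ_j⟩|² > α/N}/K` for `0 ≤ α ≤ 1`, via `anticoncentration_exact`.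
* `stabilizerQubit_isStateTwoDesign` — non-vacuity: the six one-qubit stabilizer states (a
  complete set of MUB in `ℂ²`) satisfy the design identity (16 entries, by computation).

Section `CollisionProbability` (v3) — Dalzell–Hunter-Jones–Brandão's vocabulary:

* `collisionProb p = Σ_x p(x)²`, `IsAnticoncentrated α p` (Definition 3: `Z ≤ 1/(|M| α)`),
  `IsAnticoncentratedEnsemble α μ p` (Definition 4, finite weighted form: `Σ_ω μ_ω Z(p_ω) ≤ 1/(N α)`);
  `inv_card_le_collisionProb` (`1/|M| ≤ Z`), `collisionProb_uniform` (`Z(uniform) = 1/|M|`),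
  `isAnticoncentrated_one_uniform`.
* `anticoncentration_of_collision_bound` — the Paley–Zygmund step
  `(1−β)² α ≤ Pr_μ[p(x) > β/N]` from `𝔼_μ[p(x)] = 1/N` and `𝔼_μ[p(x)²] ≤ 1/(α N²)`, and
  `second_moment_le_of_isAnticoncentratedEnsemble` — the latter bound from Definition 4 under the
  outcome symmetry `𝔼_μ[p(x)²] = 𝔼_μ[p(y)²]`.
* `IsAnticoncentratedEnsemble.markov` (v4) — “at least a 1−β fraction of instances have collision
  probability at most q⁻ⁿ(1 + (α⁻¹−1)β⁻¹)” (Markov on `Z − q⁻ⁿ ≥ 0`).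
* **`IsStateTwoDesign.avg_collisionProb`** — exact state 2-designs have average collision
  probability `Z = 2/(N+1)` (`= Z_H`), hence `IsStateTwoDesign.isAnticoncentratedEnsemble_half`
  (“and thus also 1/2-anti-concentrates”).

Section `HaarMarginal` (v4) — Lemma 6's printed density `haarMarginalDensity N p = (N−1)(1−p)^{N−2}`
on `[0,1]`: `integral_haarMarginalDensity` (`∫₀¹ = 1`), `integral_mul_haarMarginalDensity`
(`𝔼[p] = 1/N`), `integral_sq_mul_haarMarginalDensity` (`𝔼[p²] = 2/(N(N+1))`) for `N ≥ 2`, through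
the Beta integrals `∫₀¹ (1−p)^k`, `∫₀¹ p(1−p)^k`, `∫₀¹ p²(1−p)^k` (private).
-/

noncomputable section

open Finset

namespace Literature.Computability.QuantumComplexity

namespace DesignAnticoncentration

variable {Ω : Type*} [Fintype Ω]

/-- **Paley–Zygmund, weighted finite form with a strict tail**: for weights `μ ≥ 0`, a quantity
`Z` and a level `0 ≤ a` with `a·Σμ ≤ Σ μZ` (for `a ≥ 0` the sign of `Z` is immaterial), `(Σ μZ − a·Σμ)² ≤ (Σ μZ²) · Σ_{Z > a} μ`.
[cite: HangleiterEtAl2018, §3.1 proof of Theorem 5 (“P(Z > α𝔼[Z]) ≥ (1−α)² 𝔼[Z]²/𝔼[Z²]”)] -/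
theorem paleyZygmund_weighted (μ Z : Ω → ℝ) (hμ : ∀ ω, 0 ≤ μ ω) {a : ℝ}
    (ha0 : 0 ≤ a) (ha : a * ∑ ω, μ ω ≤ ∑ ω, μ ω * Z ω) :
    (∑ ω, μ ω * Z ω - a * ∑ ω, μ ω) ^ 2 ≤
      (∑ ω, μ ω * Z ω ^ 2) * ∑ ω ∈ univ.filter (fun ω => a < Z ω), μ ω := by
  classical
  set A := univ.filter fun ω : Ω => a < Z ω with hA
  -- split the first moment along `{Z ≤ a} ∪ {Z > a}`
  have hsplit : ∑ ω, μ ω * Z ω ≤ a * ∑ ω, μ ω + ∑ ω ∈ A, μ ω * Z ω := by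
    have h1 : ∑ ω, μ ω * Z ω =
        ∑ ω ∈ A, μ ω * Z ω + ∑ ω ∈ univ.filter (fun ω => ¬ a < Z ω), μ ω * Z ω :=
      (sum_filter_add_sum_filter_not univ (fun ω => a < Z ω) _).symm
    have h2 : ∑ ω ∈ univ.filter (fun ω => ¬ a < Z ω), μ ω * Z ω ≤
        ∑ ω ∈ univ.filter (fun ω => ¬ a < Z ω), μ ω * a :=
      sum_le_sum fun ω hω => mul_le_mul_of_nonneg_left (le_of_not_gt (mem_filter.1 hω).2) (hμ ω)
    have h3 : ∑ ω ∈ univ.filter (fun ω => ¬ a < Z ω), μ ω * a ≤ a * ∑ ω, μ ω := by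
      rw [← sum_mul, mul_comm]
      exact mul_le_mul_of_nonneg_left
        (sum_le_sum_of_subset_of_nonneg (filter_subset _ _) fun ω _ _ => hμ ω) ha0
    linarith
  have hpos : 0 ≤ ∑ ω, μ ω * Z ω - a * ∑ ω, μ ω := by linarith
  have hle : ∑ ω, μ ω * Z ω - a * ∑ ω, μ ω ≤ ∑ ω ∈ A, μ ω * Z ω := by linarith
  -- weighted Cauchy–Schwarz on `A`
  have hCS : (∑ ω ∈ A, μ ω * Z ω) ^ 2 ≤ (∑ ω, μ ω * Z ω ^ 2) * ∑ ω ∈ A, μ ω := by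
    have h := sum_sq_le_sum_mul_sum_of_sq_le_mul (R := ℝ) univ
      (f := fun ω => μ ω * Z ω ^ 2) (g := fun ω => if ω ∈ A then μ ω else 0)
      (r := fun ω => if ω ∈ A then μ ω * Z ω else 0)
      (fun ω _ => mul_nonneg (hμ ω) (sq_nonneg _)) (fun ω _ => by split_ifs <;> simp [hμ ω])
      (fun ω _ => by split_ifs <;> nlinarith [hμ ω])
    have hr : ∑ ω, (if ω ∈ A then μ ω * Z ω else 0) = ∑ ω ∈ A, μ ω * Z ω := by
      rw [← sum_filter]; congr 1; ext ω; simp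
    have hg : ∑ ω, (if ω ∈ A then μ ω else 0) = ∑ ω ∈ A, μ ω := by
      rw [← sum_filter]; congr 1; ext ω; simp
    rw [hr, hg] at h
    exact h
  calc (∑ ω, μ ω * Z ω - a * ∑ ω, μ ω) ^ 2 ≤ (∑ ω ∈ A, μ ω * Z ω) ^ 2 :=
        pow_le_pow_left₀ hpos hle 2
    _ ≤ (∑ ω, μ ω * Z ω ^ 2) * ∑ ω ∈ A, μ ω := hCS

/-- **Theorem 5, sharper intermediate form.**  If `p` has, under the finitely supported
distribution `μ`, first moment `≥ (1−ε)/N` and second moment `≤ (1+ε)·2/(N(N+1))` (the moment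
bounds of a relative ε-approximate 2-design with the Haar values of Lemma 6 inserted), then for
`0 ≤ α ≤ 1`: `(1−α)² · (N+1)/(2N) · (1−ε)²/(1+ε) ≤ Pr_μ[p > α(1−ε)/N]`.
[cite: HangleiterEtAl2018, Theorem 5 (proof, display “≥ (1−α)² N(N+1)/(2N²) · (1−ε)²/(1+ε)”)] -/
theorem anticoncentration_of_moment_bounds' (μ p : Ω → ℝ) (hμ : ∀ ω, 0 ≤ μ ω)
    (hμ1 : ∑ ω, μ ω = 1) {N : ℕ} (hN : 0 < N) {ε α : ℝ} (hε0 : 0 ≤ ε)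
    (hε1 : ε < 1) (hα0 : 0 ≤ α) (hα1 : α ≤ 1)
    (hm1 : (1 - ε) / N ≤ ∑ ω, μ ω * p ω)
    (hm2 : ∑ ω, μ ω * p ω ^ 2 ≤ (1 + ε) * (2 / ((N : ℝ) * (N + 1)))) :
    (1 - α) ^ 2 * (((N : ℝ) + 1) / (2 * N)) * ((1 - ε) ^ 2 / (1 + ε)) ≤
      ∑ ω ∈ univ.filter (fun ω => α * (1 - ε) / N < p ω), μ ω := by
  have hNr : (0 : ℝ) < N := by exact_mod_cast hN
  set m := ∑ ω, μ ω * p ω with hm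
  set P := ∑ ω ∈ univ.filter (fun ω => α * (1 - ε) / N < p ω), μ ω with hP
  have hP0 : 0 ≤ P := sum_nonneg fun ω _ => hμ ω
  -- Paley–Zygmund at the level `a = α(1−ε)/N ≤ α m ≤ m`
  have ha0 : 0 ≤ α * (1 - ε) / N := by
    apply div_nonneg (mul_nonneg hα0 (by linarith)) hNr.le
  have hle1 : α * (1 - ε) / N ≤ (1 - ε) / N := by
    rw [div_le_div_iff_of_pos_right hNr]
    nlinarith
  have ha : α * (1 - ε) / N * ∑ ω, μ ω ≤ m := by
    rw [hμ1, mul_one]; exact hle1.trans hm1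
  have hPZ := paleyZygmund_weighted μ p hμ ha0 ha
  rw [hμ1, mul_one] at hPZ
  -- `(1−α)(1−ε)/N ≤ m − a`
  have hgap : (1 - α) * (1 - ε) / N ≤ m - α * (1 - ε) / N := by
    have : (1 - α) * (1 - ε) / N = (1 - ε) / N - α * (1 - ε) / N := by ring
    rw [this]; linarith
  have hgap0 : 0 ≤ (1 - α) * (1 - ε) / N :=
    div_nonneg (mul_nonneg (by linarith) (by linarith)) hNr.le
  have h1 : ((1 - α) * (1 - ε) / N) ^ 2 ≤ (1 + ε) * (2 / ((N : ℝ) * (N + 1))) * P :=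
    calc ((1 - α) * (1 - ε) / N) ^ 2 ≤ (m - α * (1 - ε) / N) ^ 2 :=
          pow_le_pow_left₀ hgap0 hgap 2
      _ ≤ (∑ ω, μ ω * p ω ^ 2) * P := hPZ
      _ ≤ (1 + ε) * (2 / ((N : ℝ) * (N + 1))) * P := mul_le_mul_of_nonneg_right hm2 hP0
  -- rearrange
  have hε' : (0 : ℝ) < 1 + ε := by linarith
  rw [show (1 - α) ^ 2 * (((N : ℝ) + 1) / (2 * N)) * ((1 - ε) ^ 2 / (1 + ε)) =
      ((1 - α) * (1 - ε) / N) ^ 2 / ((1 + ε) * (2 / ((N : ℝ) * (N + 1)))) by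
    field_simp]
  rw [div_le_iff₀ (by positivity)]
  linarith [h1]

/-- **Theorem 5 (Hangleiter–Bermejo-Vega–Schwarz–Eisert) as printed**, with the design property in
the form its proof uses (relative moment bounds against the Haar moments `1/N`, `2/(N(N+1))`):
`Pr_μ[p > α(1−ε)/N] ≥ (1−α)²(1−ε)²/(2(1+ε))` for `0 ≤ α ≤ 1`.
The hypotheses `0 ≤ ε` and `ε < 1` are NOT printed in Theorem 5 (a relative ε-approximate design is
only interesting for small ε): they are a necessary correction of the print rather than a weakening —
for `ε ≥ 1` the lower moment bound `(1−ε)·(1/N) ≤ 𝔼p` is vacuous and the printed right-hand side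
can exceed `1` (e.g. `ε = 5`, `α = 0` gives `16/12`), so the displayed inequality is false as a
statement about a probability there (referee reading note LEAN-DAC-1, REFEREE §1.176(d)).
[cite: HangleiterEtAl2018, Theorem 5] -/
theorem anticoncentration_of_moment_bounds (μ p : Ω → ℝ) (hμ : ∀ ω, 0 ≤ μ ω)
    (hμ1 : ∑ ω, μ ω = 1) {N : ℕ} (hN : 0 < N) {ε α : ℝ} (hε0 : 0 ≤ ε)
    (hε1 : ε < 1) (hα0 : 0 ≤ α) (hα1 : α ≤ 1)
    (hm1 : (1 - ε) / N ≤ ∑ ω, μ ω * p ω)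
    (hm2 : ∑ ω, μ ω * p ω ^ 2 ≤ (1 + ε) * (2 / ((N : ℝ) * (N + 1)))) :
    (1 - α) ^ 2 * (1 - ε) ^ 2 / (2 * (1 + ε)) ≤
      ∑ ω ∈ univ.filter (fun ω => α * (1 - ε) / N < p ω), μ ω := by
  have h := anticoncentration_of_moment_bounds' μ p hμ hμ1 hN hε0 hε1 hα0 hα1 hm1 hm2
  have hNr : (0 : ℝ) < N := by exact_mod_cast hN
  have hε' : (0 : ℝ) < 1 + ε := by linarith
  -- `(N+1)/(2N) ≥ 1/2`
  have hfac : (1 : ℝ) / 2 ≤ ((N : ℝ) + 1) / (2 * N) := by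
    rw [div_le_div_iff₀ (by norm_num) (by positivity)]
    nlinarith
  have hnonneg : 0 ≤ (1 - α) ^ 2 * ((1 - ε) ^ 2 / (1 + ε)) := by positivity
  calc (1 - α) ^ 2 * (1 - ε) ^ 2 / (2 * (1 + ε))
      = (1 - α) ^ 2 * (1 / 2) * ((1 - ε) ^ 2 / (1 + ε)) := by
        field_simp
    _ ≤ (1 - α) ^ 2 * (((N : ℝ) + 1) / (2 * N)) * ((1 - ε) ^ 2 / (1 + ε)) := by
        have := mul_le_mul_of_nonneg_left hfac (sq_nonneg (1 - α))
        nlinarith [this, div_nonneg (sq_nonneg (1 - ε)) hε'.le]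
    _ ≤ _ := h

/-- **Exact 2-designs (`ε = 0`)**: first moment `1/N`, second moment at most `2/(N(N+1))` ⇒
`Pr_μ[p > α/N] ≥ (1−α)²/2`. [cite: HangleiterEtAl2018, Theorem 5 (case ε = 0, Definition 2)] -/
theorem anticoncentration_exact (μ p : Ω → ℝ) (hμ : ∀ ω, 0 ≤ μ ω) (hμ1 : ∑ ω, μ ω = 1)
    {N : ℕ} (hN : 0 < N) {α : ℝ} (hα0 : 0 ≤ α) (hα1 : α ≤ 1)
    (hm1 : (1 : ℝ) / N ≤ ∑ ω, μ ω * p ω)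
    (hm2 : ∑ ω, μ ω * p ω ^ 2 ≤ 2 / ((N : ℝ) * (N + 1))) :
    (1 - α) ^ 2 / 2 ≤ ∑ ω ∈ univ.filter (fun ω => α / N < p ω), μ ω := by
  have h := anticoncentration_of_moment_bounds μ p hμ hμ1 hN (ε := 0) (α := α) le_rfl
    (by norm_num) hα0 hα1 (by simpa using hm1) (by simpa using hm2)
  simpa using h

section StateDesigns

/-! ### State 2-designs (v2): the moments from the design identity -/

open Matrix
open scoped Kronecker ComplexConjugate

variable {V : Type*} [Fintype V] [DecidableEq V]
variable {J : Type*} [Fintype J]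

/-- The rank-one projector `|ψ⟩⟨ψ|` of a vector `ψ ∈ ℂ^V` in the computational basis:
`(|ψ⟩⟨ψ|)_{ab} = ψ_a ψ̄_b`. [cite: ZhuEtAl2016, §2 Proposition 1 (“(|ψ_j⟩⟨ψ_j|)^{⊗t}”)] -/
def proj (ψ : V → ℂ) : Matrix V V ℂ := vecMulVec ψ (star ψ)

/-- The swap (flip) operator `F|a c⟩ = |c a⟩` on `ℂ^V ⊗ ℂ^V`, in the product basis:
`F_{(a,c),(b,d)} = [a = d][c = b]`; `P_[2] = (𝟙 + F)/2` is the projector onto the symmetric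
subspace, of dimension `D_[2] = N(N+1)/2`. [cite: ZhuEtAl2016, §2 (“Let Sym_t(ℂ^d) be the t-partite symmetric subspace … with corresponding projector P_[t] … D_[t] = binom(d+t−1, t)”)] -/
def swapOp (V : Type*) [DecidableEq V] : Matrix (V × V) (V × V) ℂ :=
  Matrix.of fun p q => if p.1 = q.2 ∧ p.2 = q.1 then 1 else 0

/-- **Complex projective (state) 2-design**, by statement 2 of Zhu–Kueng–Grassl–Gross's
Proposition 1 at `t = 2`: a family `{ψ_j}_{j∈J}` of `K = |J|` unit vectors in `ℂ^V` (`N = |V|`)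
with `(1/K) Σ_j (|ψ_j⟩⟨ψ_j|)^{⊗2} = P_[2]/D_[2] = (𝟙 + F)/(N(N+1))`.
[cite: ZhuEtAl2016, §2 Definition 1 and Proposition 1 (“{ψ_j} is a t-design ⇔ (1/K)Σ_j (|ψ_j⟩⟨ψ_j|)^{⊗t} = P_[t]/D_[t]”)] -/
structure IsStateTwoDesign (ψ : J → V → ℂ) : Prop where
  /-- every `ψ_j` is a unit vector -/
  norm_sq : ∀ j, ∑ a, Complex.normSq (ψ j a) = 1
  /-- the design identity `(1/K) Σ_j (|ψ_j⟩⟨ψ_j|)^{⊗2} = (𝟙 + F)/(N(N+1))` -/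
  tensor_two :
    ((Fintype.card J : ℂ))⁻¹ • ∑ j, proj (ψ j) ⊗ₖ proj (ψ j) =
      (((Fintype.card V : ℂ)) * (Fintype.card V + 1))⁻¹ • ((1 : Matrix (V × V) (V × V) ℂ) + swapOp V)

omit [Fintype V] [DecidableEq V] in
/-- Diagonal entries of `|ψ⟩⟨ψ| ⊗ |ψ⟩⟨ψ|`: `⟨a c|(|ψ⟩⟨ψ|)^{⊗2}|a c⟩ = |ψ_a|²|ψ_c|²`. [folklore] -/
private theorem proj_kron_diag (ψ : V → ℂ) (a c : V) :
    (proj ψ ⊗ₖ proj ψ) (a, c) (a, c) = ((Complex.normSq (ψ a) * Complex.normSq (ψ c) : ℝ) : ℂ) := by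
  rw [kroneckerMap_apply, proj, vecMulVec_apply, vecMulVec_apply]
  simp only [Pi.star_apply, Complex.star_def, Complex.mul_conj]
  push_cast; ring

/-- **Fourth moment of a state 2-design**: `(1/K) Σ_j |⟨x|ψ_j⟩|⁴ = 2/(N(N+1))`
(the `(x x, x x)` entry of the design identity: `⟨xx|(𝟙+F)|xx⟩ = 2`).
[cite: HangleiterEtAl2018, §3.1 (“the moments of the output probabilities of state 2-designs are also given by (eq:firstandsecondmoment)”: 𝔼[p²] = 2/(N(N+1)))] -/
theorem IsStateTwoDesign.fourth_moment {ψ : J → V → ℂ} (h : IsStateTwoDesign ψ) (x : V) :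
    ((Fintype.card J : ℝ))⁻¹ * ∑ j, Complex.normSq (ψ j x) ^ 2 =
      2 / ((Fintype.card V : ℝ) * (Fintype.card V + 1)) := by
  have hx := congr_fun (congr_fun h.tensor_two (x, x)) (x, x)
  rw [Matrix.smul_apply, Matrix.sum_apply, Matrix.smul_apply, Matrix.add_apply, Matrix.one_apply_eq,
    swapOp, Matrix.of_apply, if_pos ⟨rfl, rfl⟩] at hx
  simp_rw [proj_kron_diag] at hx
  apply Complex.ofReal_injective
  push_cast
  rw [← Complex.ofReal_natCast, ← Complex.ofReal_natCast] at hx ⊢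
  simp only [smul_eq_mul] at hx
  rw [show (∑ j, ((Complex.normSq (ψ j x) : ℂ)) ^ 2) =
      ∑ j, (((Complex.normSq (ψ j x) * Complex.normSq (ψ j x) : ℝ)) : ℂ) from
    sum_congr rfl fun j _ => by push_cast; ring]
  rw [hx]
  norm_num [div_eq_mul_inv, mul_comm]

/-- **Second moment of a state 2-design**: `(1/K) Σ_j |⟨x|ψ_j⟩|² = 1/N` (sum the `(x y, x y)`
entries over `y`: `Σ_y ⟨xy|(𝟙+F)|xy⟩ = N + 1`, and `Σ_y |ψ_y|² = 1`).
[cite: HangleiterEtAl2018, §3.1 (𝔼[p] = 1/N for state 2-designs)] -/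
theorem IsStateTwoDesign.second_moment {ψ : J → V → ℂ} (h : IsStateTwoDesign ψ) (x : V) :
    ((Fintype.card J : ℝ))⁻¹ * ∑ j, Complex.normSq (ψ j x) = 1 / (Fintype.card V : ℝ) := by
  classical
  have hN : (0 : ℝ) < Fintype.card V := by
    have : Nonempty V := ⟨x⟩
    exact_mod_cast Fintype.card_pos
  -- sum the `((x,y),(x,y))` entries over `y`
  have hy : ∀ y, ((Fintype.card J : ℂ))⁻¹ * ∑ j, ((Complex.normSq (ψ j x) * Complex.normSq (ψ j y) : ℝ) : ℂ) =
      (((Fintype.card V : ℂ)) * (Fintype.card V + 1))⁻¹ * (1 + if x = y then 1 else 0) := by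
    intro y
    have hxy := congr_fun (congr_fun h.tensor_two (x, y)) (x, y)
    rw [Matrix.smul_apply, Matrix.sum_apply, Matrix.smul_apply, Matrix.add_apply, Matrix.one_apply_eq,
      swapOp, Matrix.of_apply] at hxy
    simp_rw [proj_kron_diag] at hxy
    simp only [smul_eq_mul] at hxy
    rw [hxy]
    congr 2
    by_cases hxy' : x = y
    · subst hxy'; simp
    · simp [hxy']
  have hsum := Fintype.sum_congr _ _ hy
  -- left side: `(1/K) Σ_j |ψ_j x|² Σ_y |ψ_j y|² = (1/K) Σ_j |ψ_j x|²`
  rw [← mul_sum, sum_comm] at hsum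
  have hL : ∑ j, ∑ y, (((Complex.normSq (ψ j x) * Complex.normSq (ψ j y) : ℝ)) : ℂ) =
      ∑ j, ((Complex.normSq (ψ j x) : ℝ) : ℂ) := by
    refine sum_congr rfl fun j _ => ?_
    push_cast
    rw [← mul_sum]
    have := h.norm_sq j
    rw [show (∑ y, ((Complex.normSq (ψ j y) : ℂ))) = ((∑ y, Complex.normSq (ψ j y) : ℝ) : ℂ) by
      push_cast; rfl, this]
    push_cast; ring
  rw [hL] at hsum
  -- right side: `Σ_y (1 + [x=y]) = N + 1`
  have hR : ∑ y, ((((Fintype.card V : ℂ)) * (Fintype.card V + 1))⁻¹ * (1 + if x = y then (1 : ℂ) else 0)) =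
      ((Fintype.card V : ℂ))⁻¹ := by
    rw [← mul_sum, sum_add_distrib, sum_const, card_univ, sum_ite_eq univ x, if_pos (mem_univ _),
      nsmul_eq_mul, mul_one]
    have hN' : (Fintype.card V : ℂ) ≠ 0 := by exact_mod_cast hN.ne'
    have hN1 : ((Fintype.card V : ℂ)) + 1 ≠ 0 := by
      exact_mod_cast (by positivity : ((Fintype.card V : ℝ)) + 1 ≠ 0)
    field_simp
  rw [hR] at hsum
  apply Complex.ofReal_injective
  push_cast
  rw [hsum, one_div]

/-- A state 2-design over a nonempty index space is a nonempty family (the design identity fails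
for `K = 0`, whose left side is `0`). [cite: ZhuEtAl2016, §2.1 (“Any t-design in dimension d has
at least binom(d+⌈t/2⌉−1, ⌈t/2⌉)·binom(d+⌊t/2⌋−1, ⌊t/2⌋) elements”; only K ≥ 1 is proved here)] -/
theorem IsStateTwoDesign.card_pos {ψ : J → V → ℂ} (h : IsStateTwoDesign ψ) (x : V) :
    0 < Fintype.card J := by
  rcases Nat.eq_zero_or_pos (Fintype.card J) with hK | hK
  · exfalso
    have h4 := h.fourth_moment x
    rw [hK, Nat.cast_zero, _root_.inv_zero, zero_mul] at h4
    have hN : (0 : ℝ) < Fintype.card V := by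
      have : Nonempty V := ⟨x⟩
      exact_mod_cast Fintype.card_pos
    have : (0 : ℝ) < 2 / ((Fintype.card V : ℝ) * (Fintype.card V + 1)) := by positivity
    linarith
  · exact hK

/-- **Anticoncentration of state 2-designs** (Theorem 5 “in exactly the same way for … state
2-designs”, exact case ε = 0): if `{ψ_j}_{j∈J}` is a complex projective 2-design in `ℂ^V`, `N = |V|`,
then for every basis state `x` and `0 ≤ α ≤ 1`,
`Pr_{j ∼ unif(J)}[ |⟨x|ψ_j⟩|² > α/N ] ≥ (1−α)²/2`.
[cite: HangleiterEtAl2018, Theorem 5 and §3 (“Theorem 5 also holds in exactly the same way for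
relative ε-approximate state 2-designs”), §3.1 (state-2-design moments via [zhu_clifford_2016])] -/
theorem IsStateTwoDesign.anticoncentration {ψ : J → V → ℂ} (h : IsStateTwoDesign ψ) (x : V)
    {α : ℝ} (hα0 : 0 ≤ α) (hα1 : α ≤ 1) :
    (1 - α) ^ 2 / 2 ≤
      (#(univ.filter fun j => α / (Fintype.card V) < Complex.normSq (ψ j x)) : ℝ) /
        Fintype.card J := by
  have hKr : (0 : ℝ) < Fintype.card J := by exact_mod_cast h.card_pos x
  have hN : 0 < Fintype.card V := by
    have : Nonempty V := ⟨x⟩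
    exact Fintype.card_pos
  have key := anticoncentration_exact (fun _ : J => ((Fintype.card J : ℝ))⁻¹)
    (fun j => Complex.normSq (ψ j x)) (fun _ => by positivity)
    (by rw [sum_const, card_univ, nsmul_eq_mul, mul_inv_cancel₀ hKr.ne']) hN hα0 hα1
    (by rw [← mul_sum, h.second_moment x]) (by rw [← mul_sum, h.fourth_moment x])
  rw [sum_const, nsmul_eq_mul] at key
  rw [div_eq_mul_inv]
  exact key

/-! #### Non-vacuity: the six one-qubit stabilizer states are a 2-design -/

/-- `1/√2 ∈ ℂ` (plumbing constant for the stabilizer states). [folklore] -/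
private def sqrtHalf : ℂ := ((Real.sqrt 2)⁻¹ : ℝ)

/-- `(1/√2)² = 1/2`. [folklore] -/
private lemma sqrtHalf_mul_self : sqrtHalf * sqrtHalf = 1 / 2 := by
  unfold sqrtHalf
  rw [← Complex.ofReal_mul, ← mul_inv, Real.mul_self_sqrt (by norm_num : (0:ℝ) ≤ 2)]
  push_cast; ring

/-- `1/√2` is real. [folklore] -/
private lemma conj_sqrtHalf : conj sqrtHalf = sqrtHalf := by
  unfold sqrtHalf; exact Complex.conj_ofReal _

/-- `|1/√2|² = 1/2`. [folklore] -/
private lemma normSq_sqrtHalf : Complex.normSq sqrtHalf = 1 / 2 := by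
  unfold sqrtHalf
  rw [Complex.normSq_ofReal, ← mul_inv, Real.mul_self_sqrt (by norm_num : (0:ℝ) ≤ 2)]
  norm_num

open Complex in
/-- The six one-qubit stabilizer states `|0⟩, |1⟩, |+⟩, |−⟩, |+i⟩, |−i⟩ ∈ ℂ²` (the eigenvectors of
the Pauli operators Z, X, Y). [cite: ZhuEtAl2016, §2.1 (“Another interesting example of 2-designs are
complete sets of mutually unbiased bases (MUB) … the set of stabilizer states is particularly
prominent”)] -/
def stabilizerQubit : Fin 6 → Fin 2 → ℂ :=
  ![![1, 0], ![0, 1], ![sqrtHalf, sqrtHalf], ![sqrtHalf, -sqrtHalf],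
    ![sqrtHalf, sqrtHalf * I], ![sqrtHalf, -(sqrtHalf * I)]]

/-- **Non-vacuity of `IsStateTwoDesign`**: the six one-qubit stabilizer states (a complete set of
three mutually unbiased bases of `ℂ²`) satisfy the design identity
`(1/6) Σ_j (|ψ_j⟩⟨ψ_j|)^{⊗2} = (𝟙 + F)/6`, checked entry by entry.
[cite: ZhuEtAl2016, §2.1 (“Another interesting example of 2-designs are complete sets of mutually
unbiased bases (MUB)”)] -/
theorem stabilizerQubit_isStateTwoDesign : IsStateTwoDesign stabilizerQubit := by
  constructor
  · intro j
    fin_cases j <;>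
      simp [stabilizerQubit, Fin.sum_univ_succ, normSq_sqrtHalf, Complex.normSq_neg,
        Complex.normSq_mul] <;> norm_num
  · ext ⟨a, c⟩ ⟨b, d⟩
    have h2 : sqrtHalf * sqrtHalf = 1 / 2 := sqrtHalf_mul_self
    have h4 : sqrtHalf ^ 4 = 1 / 4 := by
      rw [show sqrtHalf ^ 4 = (sqrtHalf * sqrtHalf) * (sqrtHalf * sqrtHalf) by ring, h2]; norm_num
    have hc : conj sqrtHalf = sqrtHalf := conj_sqrtHalf
    fin_cases a <;> fin_cases b <;> fin_cases c <;> fin_cases d <;>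
      simp [Fin.sum_univ_succ, kroneckerMap_apply, proj, swapOp, stabilizerQubit, hc,
        Complex.conj_I] <;> ring_nf <;> simp [Complex.I_sq] <;> ring_nf <;> norm_num [h2, h4]

end StateDesigns

section CollisionProbability

/-! ### Collision probability and α-anti-concentration (v3; Dalzell–Hunter-Jones–Brandão 2022) -/

variable {V : Type*} [Fintype V]

/-- The **collision probability** `Z := Σ_{x∈M} Pr[X = x]²` of a distribution `p` on a finite outcome
set `M` — “the probability that two identical independent copies of X will be equal to each other”.
(The Barriers file `UncorrectedNoise.lean` carries the `PMF (List Bool)` version `collisionMass`; this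
is the finite-type form used with the design vocabulary above.)
[cite: DalzellHunterJonesBrandao2022, §7.3 (display “Z := Σ_{x∈M} Pr[X=x]² = 𝔼[p²]·|M| = …”) and Definition 3] -/
def collisionProb (p : V → ℝ) : ℝ := ∑ x, p x ^ 2

/-- **Definition 3** (α-anti-concentrated distribution): “a random variable X over a set M of outcomes
is α-anti-concentrated for 0 < α ≤ 1 if Z := Σ_{x∈M} Pr[X=x]² ≤ 1/(|M| α).”
[cite: DalzellHunterJonesBrandao2022, §7.3 Definition 3] -/
def IsAnticoncentrated (α : ℝ) (p : V → ℝ) : Prop :=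
  collisionProb p ≤ 1 / ((Fintype.card V : ℝ) * α)

/-- **Definition 4** (α-anti-concentrated ensemble / “architecture”), finite weighted form: an ensemble
`ω ↦ p_ω` with weights `μ` is α-anti-concentrated if the AVERAGE collision probability satisfies
`Z := 𝔼_U[Σ_x p_U(x)²] ≤ (α qⁿ)⁻¹` (`|V| = qⁿ`).
[cite: DalzellHunterJonesBrandao2022, §7.3 Definition 4 and §2 eq. (Z := 𝔼_U[Σ_x p_U(x)²])] -/
def IsAnticoncentratedEnsemble {Ω : Type*} [Fintype Ω] (α : ℝ) (μ : Ω → ℝ) (p : Ω → V → ℝ) : Prop :=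
  ∑ ω, μ ω * collisionProb (p ω) ≤ 1 / ((Fintype.card V : ℝ) * α)

/-- `Z ≥ 1/|M|` for every probability vector: “the collision probability takes its minimal value
Z = |M|⁻¹” at the uniform distribution (Cauchy–Schwarz).
[cite: DalzellHunterJonesBrandao2022, §7.3 (paragraph before Definition 3)] -/
theorem inv_card_le_collisionProb (p : V → ℝ) (hp1 : ∑ x, p x = 1) :
    1 / (Fintype.card V : ℝ) ≤ collisionProb p := by
  classical
  rcases isEmpty_or_nonempty V with hV | hV
  · simp [collisionProb, Fintype.card_eq_zero]
  have hN : (0 : ℝ) < Fintype.card V := by exact_mod_cast Fintype.card_pos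
  -- Cauchy–Schwarz: (Σ p)² ≤ |V| Σ p²
  have hcs : (∑ x, p x) ^ 2 ≤ (Fintype.card V : ℝ) * ∑ x, p x ^ 2 := by
    have := sq_sum_le_card_mul_sum_sq (s := (univ : Finset V)) (f := p)
    simpa using this
  rw [hp1, one_pow] at hcs
  rw [collisionProb, div_le_iff₀ hN, mul_comm]
  exact hcs

/-- The uniform distribution has `Z = 1/|M|` (“1-anti-concentrated if and only if it is the uniform
distribution” — the ‘if’ direction). [cite: DalzellHunterJonesBrandao2022, §7.3 (sentence after Definition 3)] -/
theorem collisionProb_uniform [Nonempty V] :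
    collisionProb (fun _ : V => ((Fintype.card V : ℝ))⁻¹) = 1 / (Fintype.card V : ℝ) := by
  have hN : (0 : ℝ) < Fintype.card V := by exact_mod_cast Fintype.card_pos
  rw [collisionProb, sum_const, card_univ, nsmul_eq_mul]
  field_simp

/-- “Thus a distribution is 1-anti-concentrated if [and only if] it is the uniform distribution” — the
uniform distribution is 1-anti-concentrated (non-vacuity of Definition 3).
[cite: DalzellHunterJonesBrandao2022, §7.3 (sentence after Definition 3)] -/
theorem isAnticoncentrated_one_uniform [Nonempty V] :
    IsAnticoncentrated 1 (fun _ : V => ((Fintype.card V : ℝ))⁻¹) := by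
  unfold IsAnticoncentrated
  rw [collisionProb_uniform, mul_one]

/-- **Anti-concentration from a collision-probability bound** (the Paley–Zygmund step): if, at a fixed
outcome `x`, the ensemble has first moment `𝔼_μ[p(x)] = 1/N` and second moment
`𝔼_μ[p(x)²] ≤ 1/(α N²)` — which is what an α-anti-concentrated architecture gives under the
outcome symmetry “p_U(x) is distributed identically for every x”, `Z = qⁿ 𝔼_U[p_U(1ⁿ)²]` — then
“for any β with 0 ≤ β ≤ 1, Pr_U[p_U(x) ≥ β q⁻ⁿ] ≥ (1−β)² α, which follows directly from the
Paley–Zygmund inequality” (proved with the strict tail `>`, which is stronger).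
[cite: DalzellHunterJonesBrandao2022, §7.3 (display after Definition 4: Pr_U[p_U(x) ≥ β q⁻ⁿ] ≥ (1−β)²α) and eq. (Z = qⁿ 𝔼_U[p_U(1ⁿ)²])] -/
theorem anticoncentration_of_collision_bound {Ω : Type*} [Fintype Ω] (μ : Ω → ℝ) (q : Ω → ℝ)
    (hμ : ∀ ω, 0 ≤ μ ω) (hμ1 : ∑ ω, μ ω = 1) {N : ℕ} (hN : 0 < N) {α β : ℝ} (hα : 0 < α)
    (hβ0 : 0 ≤ β) (hβ1 : β ≤ 1)
    (hm1 : ∑ ω, μ ω * q ω = 1 / N) (hm2 : ∑ ω, μ ω * q ω ^ 2 ≤ 1 / (α * (N : ℝ) ^ 2)) :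
    (1 - β) ^ 2 * α ≤ ∑ ω ∈ univ.filter (fun ω => β / N < q ω), μ ω := by
  have hNr : (0 : ℝ) < N := by exact_mod_cast hN
  -- Paley–Zygmund at level `a = β/N ≤ 𝔼 q = 1/N`
  have hPZ := paleyZygmund_weighted μ q hμ (a := β / N) (by positivity)
    (by rw [hμ1, mul_one, hm1]; exact div_le_div_of_nonneg_right hβ1 hNr.le)
  rw [hμ1, mul_one, hm1] at hPZ
  -- `(1/N − β/N)² = (1−β)²/N²`, and `𝔼[q²] ≤ 1/(α N²)`
  have hPr : 0 ≤ ∑ ω ∈ univ.filter (fun ω => β / N < q ω), μ ω := sum_nonneg fun ω _ => hμ ω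
  have key : ((1 - β) ^ 2 / (N : ℝ) ^ 2) ≤
      (1 / (α * (N : ℝ) ^ 2)) * ∑ ω ∈ univ.filter (fun ω => β / N < q ω), μ ω := by
    calc ((1 - β) ^ 2 / (N : ℝ) ^ 2) = (1 / (N : ℝ) - β / N) ^ 2 := by field_simp
      _ ≤ (∑ ω, μ ω * q ω ^ 2) * ∑ ω ∈ univ.filter (fun ω => β / N < q ω), μ ω := hPZ
      _ ≤ _ := mul_le_mul_of_nonneg_right hm2 hPr
  have hαN : (0 : ℝ) ≤ α * (N : ℝ) ^ 2 := by positivity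
  have hαne : α ≠ 0 := hα.ne'
  have hNne : (N : ℝ) ≠ 0 := hNr.ne'
  calc (1 - β) ^ 2 * α = α * (N : ℝ) ^ 2 * ((1 - β) ^ 2 / (N : ℝ) ^ 2) := by field_simp
    _ ≤ α * (N : ℝ) ^ 2 *
        ((1 / (α * (N : ℝ) ^ 2)) * ∑ ω ∈ univ.filter (fun ω => β / N < q ω), μ ω) :=
      mul_le_mul_of_nonneg_left key hαN
    _ = ∑ ω ∈ univ.filter (fun ω => β / N < q ω), μ ω := by field_simp

/-- From Definition 4 plus outcome symmetry to the pointwise second-moment bound used above: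
if the ensemble is α-anti-concentrated and `𝔼_μ[p(x)²]` does not depend on `x`
(“p_U(x) is distributed identically for every x … Z = qⁿ 𝔼_U[p_U(1ⁿ)²]”), then
`𝔼_μ[p(x)²] ≤ 1/(α N²)` for every `x`.
[cite: DalzellHunterJonesBrandao2022, §7.3 (display Z = qⁿ 𝔼_U[p_U(1ⁿ)²])] -/
theorem second_moment_le_of_isAnticoncentratedEnsemble {Ω : Type*} [Fintype Ω] {α : ℝ} (hα : 0 < α)
    {μ : Ω → ℝ} {p : Ω → V → ℝ} (h : IsAnticoncentratedEnsemble α μ p)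
    (hsym : ∀ x y : V, ∑ ω, μ ω * p ω x ^ 2 = ∑ ω, μ ω * p ω y ^ 2) (x : V) :
    ∑ ω, μ ω * p ω x ^ 2 ≤ 1 / (α * (Fintype.card V : ℝ) ^ 2) := by
  have hN : (0 : ℝ) < Fintype.card V := by
    have : Nonempty V := ⟨x⟩
    exact_mod_cast Fintype.card_pos
  -- `Σ_ω μ Z(p_ω) = Σ_y 𝔼[p(y)²] = N · 𝔼[p(x)²]`
  have hZ : ∑ ω, μ ω * collisionProb (p ω) = (Fintype.card V : ℝ) * ∑ ω, μ ω * p ω x ^ 2 := by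
    calc ∑ ω, μ ω * collisionProb (p ω) = ∑ ω, ∑ y, μ ω * p ω y ^ 2 := by
          simp only [collisionProb, mul_sum]
      _ = ∑ y, ∑ ω, μ ω * p ω y ^ 2 := sum_comm
      _ = ∑ _y : V, ∑ ω, μ ω * p ω x ^ 2 := sum_congr rfl fun y _ => hsym y x
      _ = _ := by rw [sum_const, card_univ, nsmul_eq_mul]
  unfold IsAnticoncentratedEnsemble at h
  rw [hZ] at h
  rw [le_div_iff₀ (by positivity)]
  rw [le_div_iff₀ (by positivity)] at h
  nlinarith [h, hN]

/-- **Most instances of an anti-concentrated architecture are anti-concentrated** (the Markov step):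
“Given an architecture at a certain size and a bound on its collision probability Z ≤ α⁻¹ q⁻ⁿ, we can
use Markov's inequality to assert that at least a 1−β fraction of instances have collision probability
at most q⁻ⁿ(1 + (α⁻¹ − 1)β⁻¹)” — Markov applied to the nonnegative variable `Z(p_U) − q⁻ⁿ`
(`inv_card_le_collisionProb`), for probability weights `μ` and probability vectors `p_ω`.
[cite: DalzellHunterJonesBrandao2022, §7.3 (paragraph after Definition 4)] -/
theorem IsAnticoncentratedEnsemble.markov {Ω : Type*} [Fintype Ω] {α : ℝ} {μ : Ω → ℝ}
    {p : Ω → V → ℝ} (h : IsAnticoncentratedEnsemble α μ p) (hμ : ∀ ω, 0 ≤ μ ω)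
    (hμ1 : ∑ ω, μ ω = 1) (hp : ∀ ω, ∑ x, p ω x = 1) (hα0 : 0 < α) (hα1 : α ≤ 1)
    {β : ℝ} (hβ0 : 0 < β) :
    1 - β ≤ ∑ ω ∈ univ.filter
      (fun ω => collisionProb (p ω) ≤ (1 + (α⁻¹ - 1) * β⁻¹) / (Fintype.card V : ℝ)), μ ω := by
  classical
  rcases isEmpty_or_nonempty V with hV | hV
  · -- no outcomes: `Σ_x p = 0 ≠ 1` unless Ω is empty; either way the hypothesis `hp` is absurd
    rcases isEmpty_or_nonempty Ω with hΩ | hΩ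
    · simp at hμ1
    · exact absurd (hp (Classical.arbitrary Ω)) (by simp)
  have hN : (0 : ℝ) < Fintype.card V := by exact_mod_cast Fintype.card_pos
  set N : ℝ := (Fintype.card V : ℝ) with hNdef
  set c : ℝ := (α⁻¹ - 1) / N with hc
  have hc0 : 0 ≤ c := by
    have : (1 : ℝ) ≤ α⁻¹ := one_le_inv_iff₀.mpr ⟨hα0, hα1⟩
    exact div_nonneg (by linarith) hN.le
  set B := univ.filter (fun ω => ¬ collisionProb (p ω) ≤ (1 + (α⁻¹ - 1) * β⁻¹) / N) with hB
  -- the excess `Z − 1/N` is nonnegative, its mean is at most `c`, and on `B` it exceeds `c/β`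
  have hZ : ∀ ω, 1 / N ≤ collisionProb (p ω) := fun ω => inv_card_le_collisionProb (p ω) (hp ω)
  have hmean : ∑ ω, μ ω * (collisionProb (p ω) - 1 / N) ≤ c := by
    have h1 : ∑ ω, μ ω * (collisionProb (p ω) - 1 / N) =
        ∑ ω, μ ω * collisionProb (p ω) - 1 / N := by
      simp only [mul_sub, sum_sub_distrib, ← sum_mul, hμ1, one_mul]
    rw [h1, hc]
    unfold IsAnticoncentratedEnsemble at h
    have : 1 / (N * α) - 1 / N = (α⁻¹ - 1) / N := by field_simp
    linarith [h, this]
  have hBsum : (c / β) * ∑ ω ∈ B, μ ω ≤ ∑ ω, μ ω * (collisionProb (p ω) - 1 / N) := by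
    calc (c / β) * ∑ ω ∈ B, μ ω = ∑ ω ∈ B, μ ω * (c / β) := by rw [mul_comm, sum_mul]
      _ ≤ ∑ ω ∈ B, μ ω * (collisionProb (p ω) - 1 / N) := by
          refine sum_le_sum fun ω hω => mul_le_mul_of_nonneg_left ?_ (hμ ω)
          have hω' := (mem_filter.1 hω).2
          rw [not_le] at hω'
          have : (1 + (α⁻¹ - 1) * β⁻¹) / N = 1 / N + c / β := by
            rw [hc]; field_simp
          linarith [this, hω']
      _ ≤ ∑ ω, μ ω * (collisionProb (p ω) - 1 / N) :=
          sum_le_sum_of_subset_of_nonneg (filter_subset _ _) fun ω _ _ =>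
            mul_nonneg (hμ ω) (by linarith [hZ ω])
  have hBle : ∑ ω ∈ B, μ ω ≤ β := by
    have hBnn : 0 ≤ ∑ ω ∈ B, μ ω := sum_nonneg fun ω _ => hμ ω
    rcases hc0.eq_or_lt with hc00 | hcpos
    · -- `α = 1`: the mean excess is `0`, so every instance in `B` has weight `0`
      have hall : ∑ ω, μ ω * (collisionProb (p ω) - 1 / N) = 0 :=
        le_antisymm (by rw [hc00]; exact hmean)
          (sum_nonneg fun ω _ => mul_nonneg (hμ ω) (by linarith [hZ ω]))
      have hterm : ∀ ω, μ ω * (collisionProb (p ω) - 1 / N) = 0 := fun ω =>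
        (sum_eq_zero_iff_of_nonneg fun ω _ => mul_nonneg (hμ ω) (by linarith [hZ ω])).1 hall ω
          (mem_univ _)
      have hB0 : ∑ ω ∈ B, μ ω = 0 := by
        refine sum_eq_zero fun ω hω => ?_
        have hω' := (mem_filter.1 hω).2
        rw [not_le] at hω'
        have hexcess : 0 < collisionProb (p ω) - 1 / N := by
          have : 1 / N ≤ (1 + (α⁻¹ - 1) * β⁻¹) / N := by
            apply div_le_div_of_nonneg_right _ hN.le
            have : (0 : ℝ) ≤ (α⁻¹ - 1) * β⁻¹ :=
              mul_nonneg (by linarith [one_le_inv_iff₀.mpr ⟨hα0, hα1⟩]) (inv_nonneg.2 hβ0.le)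
            linarith
          linarith
        rcases mul_eq_zero.1 (hterm ω) with h0 | h0
        · exact h0
        · exact absurd h0 hexcess.ne'
      rw [hB0]; exact hβ0.le
    · have := hBsum.trans hmean
      -- `(c/β) Σ_B μ ≤ c` with `c > 0` ⇒ `Σ_B μ ≤ β`
      rw [div_mul_eq_mul_div, div_le_iff₀ hβ0] at this
      nlinarith
  -- complement
  have hsplit : ∑ ω ∈ univ.filter
      (fun ω => collisionProb (p ω) ≤ (1 + (α⁻¹ - 1) * β⁻¹) / N), μ ω + ∑ ω ∈ B, μ ω = 1 := by
    rw [hB, sum_filter_add_sum_filter_not, hμ1]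
  linarith

variable [DecidableEq V] {J : Type*} [Fintype J]

/-- **Exact 2-designs have `Z = 2/(N+1)`**: “as the collision probability is a second moment
quantity, where p_U(x)² = |⟨x|U|1ⁿ⟩|⁴, for an exact unitary 2-design μ we find
Z = 𝔼_μ[Σ_x p_U(x)²] = 𝔼_H[Σ_x p_U(x)²] = 2/(qⁿ+1)” — here for an exact STATE 2-design (the states
`U|1ⁿ⟩`), from `IsStateTwoDesign.fourth_moment` summed over `x`.
[cite: DalzellHunterJonesBrandao2022, App. ‘Approximate 2-designs and anti-concentration’ (display Z = 2/(qⁿ+1)); §2 eq. (Z_H := 2/(qⁿ+1))] -/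
theorem IsStateTwoDesign.avg_collisionProb {ψ : J → V → ℂ} (h : IsStateTwoDesign ψ) [Nonempty V] :
    ((Fintype.card J : ℝ))⁻¹ * ∑ j, collisionProb (fun x => Complex.normSq (ψ j x)) =
      2 / ((Fintype.card V : ℝ) + 1) := by
  have hN : (0 : ℝ) < Fintype.card V := by exact_mod_cast Fintype.card_pos
  simp only [collisionProb]
  rw [sum_comm, mul_sum]
  simp_rw [h.fourth_moment]
  rw [sum_const, card_univ, nsmul_eq_mul]
  field_simp

/-- … “and thus also 1/2-anti-concentrates” (`2/(N+1) ≤ 2/N = 1/(N·½)`), for the uniform weights on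
the design. [cite: DalzellHunterJonesBrandao2022, App. ‘Approximate 2-designs and anti-concentration’] -/
theorem IsStateTwoDesign.isAnticoncentratedEnsemble_half {ψ : J → V → ℂ} (h : IsStateTwoDesign ψ)
    [Nonempty V] :
    IsAnticoncentratedEnsemble (1 / 2) (fun _ : J => ((Fintype.card J : ℝ))⁻¹)
      (fun j x => Complex.normSq (ψ j x)) := by
  have hN : (0 : ℝ) < Fintype.card V := by exact_mod_cast Fintype.card_pos
  unfold IsAnticoncentratedEnsemble
  rw [← mul_sum, h.avg_collisionProb]
  rw [div_le_div_iff₀ (by positivity) (by positivity)]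
  nlinarith

end CollisionProbability

section HaarMarginal

/-! ### Lemma 6's printed density and its moments (v4) -/

open intervalIntegral

/-- **Lemma 6 (Marginal output distribution), the printed density**: “The distribution of the
marginal output probabilities p = |⟨x|U|0⟩|² of Haar random unitaries U and arbitrary but fixed x is
given by P_Haar(p) = (N−1)(1−p)^{N−2} → N exp(−Np) (N ≫ 1).”  Only the density is transcribed; that
the Haar marginal has this law is NOT formalised (TODO(general form)).
[cite: HangleiterEtAl2018, §3.1 Lemma 6 (eq. P_Haar(p) = (N−1)(1−p)^{N−2})] -/
def haarMarginalDensity (N : ℕ) (p : ℝ) : ℝ := ((N : ℝ) - 1) * (1 - p) ^ (N - 2)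

/-- Continuous functions are interval-integrable on `[0,1]` (plumbing). [folklore] -/
private lemma ii (f : ℝ → ℝ) (hf : Continuous f) :
    IntervalIntegrable f MeasureTheory.volume (0:ℝ) 1 :=
  hf.intervalIntegrable _ _

/-- `∫₀¹ (1−p)^k dp = 1/(k+1)` (Beta integral B(1, k+1)). [folklore] -/
private theorem integral_one_sub_pow (k : ℕ) : ∫ p in (0:ℝ)..1, (1 - p) ^ k = 1 / (k + 1) := by
  have h := integral_comp_sub_left (fun u : ℝ => u ^ k) (1 : ℝ) (a := 0) (b := 1)
  simp only [sub_self, sub_zero] at h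
  rw [h, integral_pow]; simp

/-- `∫₀¹ p(1−p)^k dp = 1/((k+1)(k+2))` (Beta integral B(2, k+1)). [folklore] -/
private theorem integral_mul_one_sub_pow (k : ℕ) :
    ∫ p in (0:ℝ)..1, p * (1 - p) ^ k = 1 / (((k : ℝ) + 1) * (k + 2)) := by
  have h := integral_comp_sub_left (fun u : ℝ => (1 - u) * u ^ k) (1 : ℝ) (a := 0) (b := 1)
  simp only [sub_sub_cancel, sub_self, sub_zero] at h
  rw [h]
  have h1 : ∫ u in (0:ℝ)..1, (1 - u) * u ^ k =
      (∫ u in (0:ℝ)..1, u ^ k) - ∫ u in (0:ℝ)..1, u ^ (k + 1) := by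
    rw [← integral_sub (ii _ (by fun_prop)) (ii _ (by fun_prop))]
    congr 1; ext u; ring
  rw [h1, integral_pow, integral_pow]
  have hk1 : (k : ℝ) + 1 ≠ 0 := by positivity
  have hk2 : (k : ℝ) + 2 ≠ 0 := by positivity
  have hk2' : ((k + 1 : ℕ) : ℝ) + 1 = (k : ℝ) + 2 := by push_cast; ring
  simp only [one_pow, ne_eq, not_false_eq_true, zero_pow, sub_zero, Nat.succ_ne_zero]
  rw [hk2']
  field_simp
  ring

/-- `∫₀¹ p²(1−p)^k dp = 2/((k+1)(k+2)(k+3))` (Beta integral B(3, k+1)). [folklore] -/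
private theorem integral_sq_mul_one_sub_pow (k : ℕ) :
    ∫ p in (0:ℝ)..1, p ^ 2 * (1 - p) ^ k = 2 / (((k : ℝ) + 1) * (k + 2) * (k + 3)) := by
  have h := integral_comp_sub_left (fun u : ℝ => (1 - u) ^ 2 * u ^ k) (1 : ℝ) (a := 0) (b := 1)
  simp only [sub_sub_cancel, sub_self, sub_zero] at h
  rw [h]
  have h1 : ∫ u in (0:ℝ)..1, (1 - u) ^ 2 * u ^ k =
      ((∫ u in (0:ℝ)..1, u ^ k) - ∫ u in (0:ℝ)..1, 2 * u ^ (k + 1)) + ∫ u in (0:ℝ)..1, u ^ (k + 2) := by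
    rw [← integral_sub (ii _ (by fun_prop)) (ii _ (by fun_prop)),
      ← integral_add (ii _ (by fun_prop)) (ii _ (by fun_prop))]
    congr 1; ext u; ring
  rw [h1, integral_const_mul, integral_pow, integral_pow, integral_pow]
  have hk1 : (k : ℝ) + 1 ≠ 0 := by positivity
  have hk2 : (k : ℝ) + 2 ≠ 0 := by positivity
  have hk3 : (k : ℝ) + 3 ≠ 0 := by positivity
  have hk2' : ((k + 1 : ℕ) : ℝ) + 1 = (k : ℝ) + 2 := by push_cast; ring
  have hk3' : ((k + 2 : ℕ) : ℝ) + 1 = (k : ℝ) + 3 := by push_cast; ring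
  simp only [one_pow, ne_eq, not_false_eq_true, zero_pow, sub_zero, Nat.succ_ne_zero]
  rw [hk2', hk3']
  field_simp
  ring

/-- `((N−2 : ℕ) : ℝ) = N − 2` for `N ≥ 2` (plumbing). [folklore] -/
private lemma cast_sub_two {N : ℕ} (hN : 2 ≤ N) : ((N - 2 : ℕ) : ℝ) = (N : ℝ) - 2 := by
  rw [Nat.cast_sub hN]; norm_num

/-- Lemma 6's density is normalised: `∫₀¹ (N−1)(1−p)^{N−2} dp = 1` for `N ≥ 2`.
[cite: HangleiterEtAl2018, §3.1 Lemma 6] -/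
theorem integral_haarMarginalDensity {N : ℕ} (hN : 2 ≤ N) :
    ∫ p in (0:ℝ)..1, haarMarginalDensity N p = 1 := by
  unfold haarMarginalDensity
  rw [integral_const_mul, integral_one_sub_pow, cast_sub_two hN]
  have h2 : (2 : ℝ) ≤ N := by exact_mod_cast hN
  have hN' : (N : ℝ) - 2 + 1 ≠ 0 := by linarith
  field_simp
  ring

/-- **Lemma 6, first moment**: “𝔼_Haar[p] = 1/N” — `∫₀¹ p (N−1)(1−p)^{N−2} dp = 1/N` for `N ≥ 2`.
[cite: HangleiterEtAl2018, §3.1 Lemma 6 (eq:firstandsecondmoment)] -/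
theorem integral_mul_haarMarginalDensity {N : ℕ} (hN : 2 ≤ N) :
    ∫ p in (0:ℝ)..1, p * haarMarginalDensity N p = 1 / N := by
  unfold haarMarginalDensity
  have h1 : ∫ p in (0:ℝ)..1, p * (((N : ℝ) - 1) * (1 - p) ^ (N - 2)) =
      ((N : ℝ) - 1) * ∫ p in (0:ℝ)..1, p * (1 - p) ^ (N - 2) := by
    rw [← integral_const_mul]; congr 1; ext p; ring
  rw [h1, integral_mul_one_sub_pow, cast_sub_two hN]
  have h2 : (2 : ℝ) ≤ N := by exact_mod_cast hN
  have hN' : (N : ℝ) - 2 + 1 ≠ 0 := by linarith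
  have hN0 : (N : ℝ) - 2 + 2 ≠ 0 := by linarith
  have hN0' : (N : ℝ) ≠ 0 := by linarith
  field_simp
  ring

/-- **Lemma 6, second moment**: “𝔼_Haar[p²] = 2/(N(N+1))” —
`∫₀¹ p² (N−1)(1−p)^{N−2} dp = 2/(N(N+1))` for `N ≥ 2`.
[cite: HangleiterEtAl2018, §3.1 Lemma 6 (eq:firstandsecondmoment)] -/
theorem integral_sq_mul_haarMarginalDensity {N : ℕ} (hN : 2 ≤ N) :
    ∫ p in (0:ℝ)..1, p ^ 2 * haarMarginalDensity N p = 2 / ((N : ℝ) * (N + 1)) := by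
  unfold haarMarginalDensity
  have h1 : ∫ p in (0:ℝ)..1, p ^ 2 * (((N : ℝ) - 1) * (1 - p) ^ (N - 2)) =
      ((N : ℝ) - 1) * ∫ p in (0:ℝ)..1, p ^ 2 * (1 - p) ^ (N - 2) := by
    rw [← integral_const_mul]; congr 1; ext p; ring
  rw [h1, integral_sq_mul_one_sub_pow, cast_sub_two hN]
  have h2 : (2 : ℝ) ≤ N := by exact_mod_cast hN
  have hN' : (N : ℝ) - 2 + 1 ≠ 0 := by linarith
  have hN0 : (N : ℝ) - 2 + 2 ≠ 0 := by linarith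
  have hN1 : (N : ℝ) - 2 + 3 ≠ 0 := by linarith
  have hN0' : (N : ℝ) ≠ 0 := by linarith
  have hN1' : (N : ℝ) + 1 ≠ 0 := by linarith
  field_simp
  ring

end HaarMarginal

end DesignAnticoncentration

end Literature.Computability.QuantumComplexity
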